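import Summits.KontsevichZagierPeriods.KontsevichZagierPeriods.Theorems.SoloBlindCyclicIntegrable
import HarnessLib

/-!
# The two-exponent form `z^α (1-z)^β dz` on the half-plane, IV: the two boundary traces

Integrability of the two traces of the Green identity for `g_{αβ}(z) = z^α (1-z)^β`
(`-1 < α ≤ 0`, `-1 ≤ β ≤ 0`, `α + β < -1`):
* on the axis `x = ½`: `y ↦ Re g_{αβ}(½+iy)` is integrable on `(0, ∞)` (bounded by `4` on
  `(0,1]`, by `y^{α+β}` on `(1,∞)`);
* on the edge `y = 0`: `x ↦ Im g_{αβ}(x)` is integrable on `(-∞,0) ∪ (0,½)`: it vanishes on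
  `(0,½)` and equals `sin(πα) (-x)^α (1-x)^β` on `(-∞,0)`, which the substitution `x = -v/(1-v)`
  carries to the Beta integrand `v^α (1-v)^{-α-β-2}` of `B(α+1, -α-β-1)`.

References: Whittaker–Watson, *Modern Analysis*, §12.41; Kontsevich–Zagier (2001), §1.2.
-/

noncomputable section

open Set Complex MeasureTheory Filter
open scoped Topology
open Literature.NumberTheory.Transcendental
open Literature.NumberTheory.Transcendental.KZ
open Literature.Analysis.SpecialFunctions.Selberg

namespace Summit.KontsevichZagierPeriods.KontsevichZagierPeriods.Theorems

namespace SoloBlind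

/-! ## The trace on the axis `x = ½` -/

/-- Continuity of `y ↦ g_{αβ}(½+iy)` on `(0, ∞)`. -/
theorem continuousOn_gTwo_mid (α β : ℝ) :
    ContinuousOn (fun y : ℝ => gTwo α β (((1 / 2 : ℝ) : ℂ) + y * I)) (Ioi 0) := by
  intro y hy
  have hs := mem_slitPlane_pair (x := 1 / 2) (mem_Ioi.mp hy)
  have hlin : Continuous fun y : ℝ => (((1 / 2 : ℝ) : ℂ)) + y * I := by fun_prop
  have h := (hasDerivAt_gTwo α β hs.1 hs.2).continuousAt.comp
    (f := fun y : ℝ => (((1 / 2 : ℝ) : ℂ)) + y * I) hlin.continuousAt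
  exact h.continuousWithinAt

/-- `|Re g_{αβ}(½+iy)| ≤ 4` for `α, β ∈ [-1, 0]`. -/
theorem abs_re_gTwo_mid_le {α β : ℝ} (hα : -1 ≤ α) (hα0 : α ≤ 0) (hβ : -1 ≤ β) (hβ0 : β ≤ 0)
    (y : ℝ) : |(gTwo α β (((1 / 2 : ℝ) : ℂ) + y * I)).re| ≤ 4 := by
  have h1 : 1 / 2 ≤ ‖(((1 / 2 : ℝ) : ℂ)) + y * I‖ := by
    have h := abs_re_le_norm ((((1 / 2 : ℝ) : ℂ)) + y * I)
    rwa [show ((((1 / 2 : ℝ) : ℂ)) + y * I).re = 1 / 2 by simp,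
      abs_of_pos (by norm_num : (0 : ℝ) < 1 / 2)] at h
  have h2 : 1 / 2 ≤ ‖1 - ((((1 / 2 : ℝ) : ℂ)) + y * I)‖ := by
    have h := abs_re_le_norm (1 - ((((1 / 2 : ℝ) : ℂ)) + y * I))
    rwa [show (1 - ((((1 / 2 : ℝ) : ℂ)) + y * I)).re = 1 / 2 by simp; norm_num,
      abs_of_pos (by norm_num : (0 : ℝ) < 1 / 2)] at h
  have hA : ‖(((1 / 2 : ℝ) : ℂ)) + y * I‖ ^ α ≤ 2 :=
    (Real.rpow_le_rpow_of_nonpos (by norm_num) h1 hα0).trans (half_rpow_le_two hα)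
  have hB : ‖1 - ((((1 / 2 : ℝ) : ℂ)) + y * I)‖ ^ β ≤ 2 :=
    (Real.rpow_le_rpow_of_nonpos (by norm_num) h2 hβ0).trans (half_rpow_le_two hβ)
  calc |(gTwo α β (((1 / 2 : ℝ) : ℂ) + y * I)).re| ≤ ‖gTwo α β (((1 / 2 : ℝ) : ℂ) + y * I)‖ :=
        abs_re_le_norm _
    _ = _ := norm_gTwo α β _
    _ ≤ 2 * 2 := mul_le_mul hA hB (by positivity) (by norm_num)
    _ = 4 := by norm_num

/-- **The axis trace `y ↦ Re g_{αβ}(½+iy)` is integrable on `(0, ∞)`.** -/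
theorem integrableOn_gTwo_mid {α β : ℝ} (hα : -1 ≤ α) (hα0 : α ≤ 0) (hβ : -1 ≤ β) (hβ0 : β ≤ 0)
    (hs : α + β < -1) :
    IntegrableOn (fun y : ℝ => (gTwo α β (((1 / 2 : ℝ) : ℂ) + y * I)).re) (Ioi 0) := by
  have hmeas : ∀ S ⊆ Ioi (0 : ℝ), MeasurableSet S →
      AEStronglyMeasurable (fun y : ℝ => (gTwo α β (((1 / 2 : ℝ) : ℂ) + y * I)).re)
        (volume.restrict S) := fun S hS hSm =>
    ((Complex.continuous_re.comp_continuousOn (continuousOn_gTwo_mid α β)).mono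
      hS).aestronglyMeasurable hSm
  rw [← Ioc_union_Ioi_eq_Ioi zero_le_one]
  refine IntegrableOn.union ?_ ?_
  · have hc : IntegrableOn (fun _ : ℝ => (4 : ℝ)) (Ioc (0 : ℝ) 1) :=
      integrableOn_const (C := (4 : ℝ)) measure_Ioc_lt_top.ne
    refine Integrable.mono' hc (hmeas _ Ioc_subset_Ioi_self measurableSet_Ioc) ?_
    refine (ae_restrict_iff' measurableSet_Ioc).mpr (Eventually.of_forall fun y _ => ?_)
    rw [Real.norm_eq_abs]
    exact abs_re_gTwo_mid_le hα hα0 hβ hβ0 y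
  · refine Integrable.mono' (integrableOn_Ioi_rpow_of_lt hs zero_lt_one)
      (hmeas _ (Ioi_subset_Ioi zero_le_one) measurableSet_Ioi) ?_
    refine (ae_restrict_iff' measurableSet_Ioi).mpr (Eventually.of_forall fun y hy => ?_)
    have hy0 : 0 < y := lt_trans zero_lt_one hy
    rw [Real.norm_eq_abs]
    exact (abs_re_le_norm _).trans (norm_gTwo_le_of_im hα0 hβ0 hy0)

/-! ## The trace on the edge `y = 0` -/

/-- **The Jacobian identity** of `x = -v/(1-v)` for the two-exponent integrand:
`(-x)^α (1-x)^β · (1/(1-v)²) = v^α (1-v)^{-α-β-2}`. -/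
theorem jacobi_negMoeb₂ (α β : ℝ) {v : ℝ} (hv : v ∈ Ioo (0 : ℝ) 1) :
    (-(-moeb v)) ^ α * (1 - -moeb v) ^ β * (1 / (1 - v) ^ 2) =
      v ^ α * (1 - v) ^ (-α - β - 2) := by
  have h1 : 0 < 1 - v := by linarith [hv.2]
  have e0 : 1 - -moeb v = 1 / (1 - v) := by
    rw [moeb]; field_simp; ring
  have e1 : (v / (1 - v)) ^ α = v ^ α * (1 - v) ^ (-α) := by
    rw [Real.div_rpow hv.1.le h1.le, Real.rpow_neg h1.le, div_eq_mul_inv]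
  have e2 : (1 / (1 - v)) ^ β = (1 - v) ^ (-β) := by
    rw [one_div, Real.inv_rpow h1.le, Real.rpow_neg h1.le]
  have e3 : 1 / (1 - v) ^ 2 = (1 - v) ^ (-2 : ℝ) := by
    rw [Real.rpow_neg h1.le, Real.rpow_two, one_div]
  rw [neg_neg, e0, moeb, e1, e2, e3, show -α - β - 2 = -α + -β + -2 by ring, Real.rpow_add h1,
    Real.rpow_add h1]
  ring

/-- `(-x)^α (1-x)^β` is integrable on `(-∞, 0)` for `-1 < α`, `α + β < -1`: under
`x = -v/(1-v)` it is the Beta integrand of `B(α+1, -α-β-1)`. -/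
theorem integrableOn_negSide₂ {α β : ℝ} (hα : -1 < α) (hs : α + β < -1) :
    IntegrableOn (fun x : ℝ => (-x) ^ α * (1 - x) ^ β) (Iio 0) := by
  have hder : ∀ v ∈ Ioo (0 : ℝ) 1,
      HasDerivWithinAt (fun v => -moeb v) (-(1 / (1 - v) ^ 2)) (Ioo 0 1) v :=
    fun v hv => (hasDerivAt_moeb (ne_of_lt hv.2)).neg.hasDerivWithinAt
  rw [← image_negMoeb,
    integrableOn_image_iff_integrableOn_abs_deriv_smul measurableSet_Ioo hder injOn_negMoeb]
  have hB := (integrableOn_Ioo_rpow_mul_one_sub_rpow_and_integral_eq (a := α + 1)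
    (b := -α - β - 1) (by linarith) (by linarith)).1
  refine hB.congr_fun (fun v hv => ?_) measurableSet_Ioo
  have h1 : 0 < 1 - v := by linarith [hv.2]
  rw [show α + 1 - 1 = α by ring, show -α - β - 1 - 1 = -α - β - 2 by ring, smul_eq_mul, abs_neg,
    abs_of_pos (by positivity : (0 : ℝ) < 1 / (1 - v) ^ 2), mul_comm (1 / (1 - v) ^ 2),
    jacobi_negMoeb₂ α β hv]

/-- **The edge trace `x ↦ Im g_{αβ}(x)` is integrable on `(-∞,0) ∪ (0,½)`.** -/
theorem integrableOn_gTwo_edge {α β : ℝ} (hα : -1 < α) (hs : α + β < -1) :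
    IntegrableOn (fun x : ℝ => (gTwo α β ((x : ℂ) + ((0 : ℝ) : ℂ) * I)).im) baseA := by
  have e : ∀ x : ℝ, (x : ℂ) + ((0 : ℝ) : ℂ) * I = x := fun x => by simp
  simp_rw [e]
  rw [baseA_eq]
  refine IntegrableOn.union ?_ ?_
  · have h : IntegrableOn (fun x : ℝ => Real.sin (Real.pi * α) * ((-x) ^ α * (1 - x) ^ β))
        (Iio 0) := (integrableOn_negSide₂ hα hs).const_mul (Real.sin (Real.pi * α))
    exact h.congr_fun (fun x hx => (im_gTwo_ofReal_neg hx).symm) measurableSet_Iio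
  · refine (integrableOn_zero : IntegrableOn (fun _ : ℝ => (0 : ℝ)) (Ioo 0 (1 / 2))).congr_fun
      (fun x hx => (im_gTwo_ofReal_pos hx.1 (by linarith [hx.2])).symm) measurableSet_Ioo

end SoloBlind

end Summit.KontsevichZagierPeriods.KontsevichZagierPeriods.Theorems
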